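import Literature.NumberTheory.GaloisRepresentations.FrobeniusQuotientHOne
import Literature.NumberTheory.GaloisRepresentations.GaloisCohomology
import Summits.BirchSwinnertonDyer.Rank1Residual.X1.StrictClassesIndex
import HarnessLib

/-!
# LP-D (characters): an UNRAMIFIED and a `ψ`-ADIC character of a local Galois group with values in
# a group of prime order, and the bound `#{f : Γ_F → A₀ | f(J) = 0} ≥ p²` (cell `b2b-bsdres`, unit
# `b2b-bsdres-eisenstein-p1`, gen 20; X1R0-GAPMAP §28.4 (LP-D), §29)

HONEST FRAMING (run/shared/lean/b2b/bsd-rank1-residual/, verbatim in every file): the goal of the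
cell is to DELETE the COMBINATION-SHAPED residual classes of the Birch–Swinnerton-Dyer formula for
ALL analytic-rank `≤ 1` elliptic curves over `ℚ` — "full BSD formula for every rank `≤ 1` curve in
class `C`" assembled STRICTLY from published theorems — so that the rank-`≤ 1` remainder becomes
exactly the CONSTRUCTION-SHAPED classes, which are TYPED (missing-input `Prop`s), NOT attempted.
This is not "finishing BSD". Sub-cell `b2b-bsdres-eisenstein-p1`: research route; NO CLAIM BEYOND
STATED CLASSES; nothing here changes a label; nothing is booked. THEOREMS ONLY — no definition, no
named fact; local Galois theory only (nothing about any curve).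

## What and why

The index `p²` of the local package (`X1/StrictClassesIndex.exists_addSubgroup_strict` with
`sq_le_natCard_subtype_forall_eq_zero`) needs two independent continuous homomorphisms
`Γ_F → A₀` (`#A₀ = p`) vanishing on `J = I_F ∩ ker ψ`, where `ψ : Γ_F → ℤ_p` is the restriction
of the cyclotomic `ℤ_p`-extension character of `ℚ_n` to the decomposition group:

* §1 `exists_cocycle_ne_zero_forall_absInertia` — an UNRAMIFIED one: `H¹(Γ_F/I_F, A₀)` has `#A₀`
  elements (tree `natCard_continuousCohomology_one_quotient_galUnr`, `h⁰ = h¹` over `\hat ℤ`), so a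
  non-zero continuous homomorphism `Γ_F/I_F → A₀` exists; inflate it.
* §2 `exists_cocycle_apply_eq_toZModPow_smul` — the `ψ`-ADIC one: `g ↦ (ψ(g) mod p) · a₀`.
* §3 **`sq_le_natCard_subtype_of_unit_on_inertia`**: if `ψ` takes a UNIT value on some inertia
  element (the `ℤ_p`-tower is ramified at the first step over `F`), the two are independent, so
  `p² ≤ #{f ∈ Z¹(Γ_F, A₀) | f(J) = 0}` for every `J ≤ I_F ∩ ker ψ`.

References: [SerreLocalFields1979] XIII §1 Prop. 1, IV §4; [MilneADT2006] I §2 Lemma 2.9;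
[GreenbergLNM1716] §3 Lemma 3.4 (the two sources of the local factor at an anomalous prime).
-/

noncomputable section

open scoped Classical
open Function CategoryTheory Field IsNonarchimedeanLocalField ValuativeRel
open Literature.NumberTheory.GaloisRepresentations

universe u

set_option autoImplicit false

namespace Summit.BirchSwinnertonDyer.Rank1Residual.X1.LocalTwoCharacters

open _root_.TopRep _root_.ContinuousCohomology

/-! ## §1. An unramified character of order `p` -/

section Unramified

variable (F : Type u) [Field F] [ValuativeRel F] [TopologicalSpace F] [IsNonarchimedeanLocalField F]
  (A₀ : Type u) [AddCommGroup A₀] [TopologicalSpace A₀] [DiscreteTopology A₀] [Finite A₀]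
  [Nontrivial A₀]

/-- **A non-zero continuous homomorphism `Γ_F → A₀` trivial on the inertia group exists** (`A₀`
finite non-trivial with trivial action): `#H¹(Γ_F/I_F, A₀) = #A₀^{Γ_F/I_F} = #A₀ > 1` (tree
`natCard_continuousCohomology_one_quotient_galUnr`, `galUnr_eq_absInertia`), `H¹ = Z¹` for the
trivial module, and inflation to `Γ_F`. [cite: SerreLocalFields1979, XIII §1 Prop. 1]
[cite: MilneADT2006, I §2 Lemma 2.9 (proof)] -/
theorem exists_cocycle_ne_zero_forall_absInertia :
    ∃ χ : contOneCocycles (ContinuousRep.trivial (absoluteGaloisGroup F) ℤ A₀).toTopRep,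
      χ ≠ 0 ∧ ∀ g ∈ absInertia F, χ.1 g = 0 := by
  haveI : IsTopologicalAddGroup A₀ := ⟨⟩
  let τ := ContinuousRep.trivial (absoluteGaloisGroup F ⧸ galUnr F) ℤ A₀
  have htrivQ : ∀ (q : absoluteGaloisGroup F ⧸ galUnr F) (x : τ.toTopRep), τ.toTopRep.ρ q x = x :=
    fun _ _ ↦ rfl
  have hcard := natCard_continuousCohomology_one_quotient_galUnr F A₀ τ
  have hinv : Nat.card τ.toTopRep.ρ.invariants = Nat.card A₀ :=
    Nat.card_congr (Equiv.subtypeUnivEquiv fun x ↦ by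
      rw [ContRepresentation.mem_invariants]; intro g; rfl)
  have hZ : Nat.card (contOneCocycles τ.toTopRep) = Nat.card A₀ := by
    rw [← natCard_continuousCohomology_one_eq_of_trivial _ htrivQ, hcard, hinv]
  have hA : 1 < Nat.card A₀ := Finite.one_lt_card
  haveI : Finite (contOneCocycles τ.toTopRep) := Nat.finite_of_card_ne_zero (by omega)
  haveI : Nontrivial (contOneCocycles τ.toTopRep) := Finite.one_lt_card_iff_nontrivial.mp (by omega)
  obtain ⟨χ₀, hχ₀⟩ := exists_ne (0 : contOneCocycles τ.toTopRep)
  let π : absoluteGaloisGroup F →ₜ* absoluteGaloisGroup F ⧸ galUnr F :=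
    ⟨QuotientGroup.mk' (galUnr F), continuous_quot_mk⟩
  refine ⟨⟨⟨χ₀.1 ∘ π, χ₀.1.continuous.comp π.continuous⟩, fun g h ↦ ?_⟩, fun h0 ↦ hχ₀ ?_,
    fun g hg ↦ ?_⟩
  · change χ₀.1 (π (g * h)) = χ₀.1 (π g) +
      (ContinuousRep.trivial (absoluteGaloisGroup F) ℤ A₀).toTopRep.ρ g (χ₀.1 (π h))
    rw [map_mul, χ₀.2]
    rfl
  · apply Subtype.ext
    ext q
    obtain ⟨g, rfl⟩ := QuotientGroup.mk_surjective q
    have := congrArg (fun f : contOneCocycles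
      (ContinuousRep.trivial (absoluteGaloisGroup F) ℤ A₀).toTopRep ↦ f.1 g) h0
    exact this
  · have hg' : g ∈ galUnr F := by rw [galUnr_eq_absInertia]; exact hg
    change χ₀.1 (π g) = 0
    have h1 : π g = 1 := (QuotientGroup.eq_one_iff g).mpr hg'
    rw [h1]
    exact contOneCocycles.apply_one χ₀

end Unramified

/-! ## §2. The `ψ`-adic character `g ↦ (ψ g mod p) · a₀` -/

section Padic

variable {G : Type u} [Group G] [TopologicalSpace G] [IsTopologicalGroup G]
  (A₀ : Type u) [AddCommGroup A₀] [TopologicalSpace A₀] [DiscreteTopology A₀]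
  {p : ℕ} [hp : Fact p.Prime]

omit [TopologicalSpace A₀] [DiscreteTopology A₀] hp in
/-- `k • a₀` depends only on `k mod n` when `n • a₀ = 0`. [folklore] -/
theorem mod_nsmul_eq {n : ℕ} {a₀ : A₀} (ha : n • a₀ = 0) (k : ℕ) : (k % n) • a₀ = k • a₀ := by
  conv_rhs => rw [← Nat.div_add_mod k n, add_nsmul, mul_nsmul, ha, nsmul_zero, zero_add]

omit [IsTopologicalGroup G] in
/-- **The continuous homomorphism `g ↦ (ψ(g) mod p) · a₀`** attached to a continuous
`ψ : G → ℤ_p` and `a₀ ∈ A₀` with `p a₀ = 0`, as a continuous crossed homomorphism of the trivial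
module. [folklore] -/
theorem exists_cocycle_apply_eq_toZModPow_smul (ψ : G →ₜ* Multiplicative ℤ_[p]) {a₀ : A₀}
    (ha : p • a₀ = 0) :
    ∃ χ : contOneCocycles (letI : IsTopologicalAddGroup A₀ := ⟨⟩;
        (ContinuousRep.trivial G ℤ A₀).toTopRep),
      ∀ g : G, χ.1 g = (PadicInt.toZModPow 1 (ψ g).toAdd).val • a₀ := by
  letI : IsTopologicalAddGroup A₀ := ⟨⟩
  have ha' : p ^ 1 • a₀ = 0 := by rw [pow_one]; exact ha
  have hcont : Continuous fun g : G ↦ (PadicInt.toZModPow 1 (ψ g).toAdd).val • a₀ :=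
    (continuous_of_discreteTopology (f := fun x : ZMod (p ^ 1) ↦ x.val • a₀)).comp
      ((PadicInt.continuous_toZModPow p 1).comp (continuous_toAdd.comp ψ.continuous))
  refine ⟨⟨⟨_, hcont⟩, fun g h ↦ ?_⟩, fun _ ↦ rfl⟩
  change (PadicInt.toZModPow 1 (ψ (g * h)).toAdd).val • a₀ =
    (PadicInt.toZModPow 1 (ψ g).toAdd).val • a₀ +
      (ContinuousRep.trivial G ℤ A₀).toTopRep.ρ g ((PadicInt.toZModPow 1 (ψ h).toAdd).val • a₀)
  rw [ContinuousRep.toTopRep_ρ_apply, ContinuousRep.trivial_apply, map_mul, toAdd_mul, map_add,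
    ZMod.val_add, mod_nsmul_eq A₀ ha', add_nsmul]

end Padic

/-! ## §3. Independence: `#{f ∈ Z¹(Γ_F, A₀) | f(J) = 0} ≥ p²` -/

section Independence

variable (F : Type u) [Field F] [ValuativeRel F] [TopologicalSpace F] [IsNonarchimedeanLocalField F]
  (A₀ : Type u) [AddCommGroup A₀] [TopologicalSpace A₀] [DiscreteTopology A₀] [Finite A₀]
  {p : ℕ} [hp : Fact p.Prime]

omit [TopologicalSpace A₀] [DiscreteTopology A₀] [Finite A₀] in
/-- In a group of prime order `p`, `p • a = 0`, and `k • a = 0` forces `p ∣ k` unless `a = 0`.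
[folklore] -/
theorem prime_dvd_of_zsmul_eq_zero (hA : Nat.card A₀ = p) {a : A₀} (ha : a ≠ 0) {k : ℤ}
    (hk : k • a = 0) : (p : ℤ) ∣ k := by
  have hpa : p • a = 0 := by rw [← hA]; exact card_nsmul_eq_zero'
  have hord : addOrderOf a = p := addOrderOf_eq_prime hpa ha
  rw [← hord]
  exact (addOrderOf_dvd_iff_zsmul_eq_zero).mpr hk

/-- **`p² ≤ #{f ∈ Z¹(Γ_F, A₀) | f(J) = 0}`** for `#A₀ = p` (trivial action), `ψ : Γ_F → ℤ_p`
continuous taking a UNIT value on some inertia element, and any `J` contained in `I_F ∩ ker ψ`: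
the unramified character of §1 and the `ψ`-adic character of §2 are independent and both vanish on
`J` (`X1/StrictClassesIndex.sq_le_natCard_subtype_forall_eq_zero`).
[cite: GreenbergLNM1716, §3 Lemma 3.4] [cite: SerreLocalFields1979, XIII §1 Prop. 1] -/
theorem sq_le_natCard_subtype_of_unit_on_inertia (hA : Nat.card A₀ = p)
    (ψ : absoluteGaloisGroup F →ₜ* Multiplicative ℤ_[p])
    (hI : ∃ g ∈ absInertia F, ¬ (p : ℤ_[p]) ∣ (ψ g).toAdd)
    (J : Subgroup (absoluteGaloisGroup F)) (hJI : J ≤ absInertia F) (hJψ : ∀ g ∈ J, ψ g = 1)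
    [Finite (contOneCocycles (letI : IsTopologicalAddGroup A₀ := ⟨⟩;
      (ContinuousRep.trivial (absoluteGaloisGroup F) ℤ A₀).toTopRep))] :
    p ^ 2 ≤ Nat.card {f : contOneCocycles (letI : IsTopologicalAddGroup A₀ := ⟨⟩;
        (ContinuousRep.trivial (absoluteGaloisGroup F) ℤ A₀).toTopRep) // ∀ g ∈ J, f.1 g = 0} := by
  letI : IsTopologicalAddGroup A₀ := ⟨⟩
  haveI : Nontrivial A₀ := Finite.one_lt_card_iff_nontrivial.mp (by rw [hA]; exact hp.out.one_lt)
  -- the unramified character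
  obtain ⟨χ₁, hχ₁0, hχ₁I⟩ := exists_cocycle_ne_zero_forall_absInertia F A₀
  -- the `ψ`-adic character on a non-zero `a₀`
  obtain ⟨a₀, ha₀⟩ := exists_ne (0 : A₀)
  have hpa₀ : p • a₀ = 0 := by rw [← hA]; exact card_nsmul_eq_zero'
  obtain ⟨χ₂, hχ₂⟩ := exists_cocycle_apply_eq_toZModPow_smul A₀ ψ hpa₀
  refine StrictClassesIndex.sq_le_natCard_subtype_forall_eq_zero J χ₁ χ₂
    (fun g hg ↦ hχ₁I g (hJI hg)) (fun g hg ↦ ?_) fun a b hab ↦ ?_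
  · rw [hχ₂ g, hJψ g hg, toAdd_one, map_zero, ZMod.val_zero, zero_smul]
  · -- evaluate at an inertia element with unit value: `p ∣ b`
    obtain ⟨g₁, hg₁I, hg₁u⟩ := hI
    have hu : PadicInt.toZModPow 1 (ψ g₁).toAdd ≠ 0 := by
      intro h0
      apply hg₁u
      have hmem : (ψ g₁).toAdd ∈ RingHom.ker (PadicInt.toZModPow (p := p) 1) := h0
      rw [PadicInt.ker_toZModPow, Ideal.mem_span_singleton, pow_one] at hmem
      exact hmem
    have hb : (p : ℤ) ∣ b := by
      have h1 := hab g₁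
      rw [hχ₁I g₁ hg₁I, smul_zero, zero_add, hχ₂ g₁, ← natCast_zsmul, smul_smul] at h1
      have h2 := prime_dvd_of_zsmul_eq_zero A₀ hA ha₀ h1
      rcases (Nat.prime_iff_prime_int.mp hp.out).dvd_or_dvd h2 with h3 | h3
      · exact h3
      · exfalso
        apply hu
        have hlt : (PadicInt.toZModPow 1 (ψ g₁).toAdd).val < p :=
          lt_of_lt_of_eq (ZMod.val_lt _) (pow_one p)
        have h4 : ((PadicInt.toZModPow 1 (ψ g₁).toAdd).val : ℤ) = 0 :=
          Int.eq_zero_of_dvd_of_natAbs_lt_natAbs h3 (by omega)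
        exact (ZMod.val_eq_zero _).mp (by exact_mod_cast h4)
    -- hence `a • χ₁ = 0`, and `χ₁ ≠ 0` gives `p ∣ a`
    have hbχ₂ : ∀ g, b • χ₂.1 g = 0 := fun g ↦ by
      obtain ⟨c, rfl⟩ := hb
      rw [hχ₂ g, mul_comm, mul_zsmul, natCast_zsmul, smul_comm p, hpa₀, smul_zero, smul_zero]
    have haχ₁ : ∀ g, a • χ₁.1 g = 0 := fun g ↦ by
      have h1 := hab g
      rwa [hbχ₂ g, add_zero] at h1
    have hg₂ : ∃ g₂, χ₁.1 g₂ ≠ 0 := by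
      by_contra hcon
      push Not at hcon
      exact hχ₁0 (Subtype.ext (ContinuousMap.ext hcon))
    obtain ⟨g₂, hg₂⟩ := hg₂
    exact ⟨prime_dvd_of_zsmul_eq_zero A₀ hA hg₂ (haχ₁ g₂), hb⟩

end Independence

end Summit.BirchSwinnertonDyer.Rank1Residual.X1.LocalTwoCharacters

end
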